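import Mathlib
import HarnessLib

/-!
# Far-edge descent — the corner lemmas: gain inequalities and the exclusion (kernel XLVIII-A, lens-2 g63)

The four elementary inequalities behind the symbolic treatment of the open corner `199/100 ≤ β < 2`
of the dial (kernel XLVIII, `FarEdgeDescentCornerSymbolic`), all over the pinned one- and two-factor region
of the region criterion (`FarEdgeDescentNarrownessPotential.RegionCriterion`), with `α = ε+1−V`:

* `lemma_I` — `z λ α ≤ (16/25)(1 − (β−1)λ)` (pin only; `β ≥ 25/16`, `z(1+ε) = 1`, `z ≥ 9/10`): chord
  condition (I) per factor, a discriminant;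
* `lemma_U` — the GAIN inequality `β(2+V)·λα ≤ 2(1+ε)(1 − (β−1)λ)` (pin only; `2ε(3β−1) ≤ 2−β`): at the
  pin boundary the slack is the explicit sum of squares `V·[β(1−ε)(1−V)² + ((2−β) − 2ε(3β−1))V + βV³]`;
* `lemma_U'` — its sharpening `β((1+ε) + (1−4(2−β))V)·λα ≤ (1+ε)²(1 − (β−1)λ)` on the deep range
  `V ≤ 4(2−β)`;
* `exclusion_sum` — on the deep range the product-floor exclusion `V_f ≤ V_P` forces
  `V + V' ≥ (293/100)·V_f` (both factors cannot sit at the floor);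
* `pair_II` — chord condition (II) `z·λλ'αα' ≤ (9/25)A + (7/50)B` for a pair, from the above and
  `V_f ≥ (12/25)(2−β)`: `lemma_U` on both factors if one has `V ≥ 4(2−β)`, else `lemma_U'` on both plus
  `exclusion_sum`.

Pure real polynomial inequalities; no `sorry`, no definitions.
-/

noncomputable section

set_option linter.dupNamespace false
set_option linter.style.longLine false

namespace Summit.MatrixMultiplication.MatrixMultiplication.Theorems.FarEdgeDescentCornerLemmas


/-! ## 1. Per-factor lemmas (pin only) -/

/-- **(I) per factor.**  `z λ (ε+1−V) ≤ (16/25)(1 − (β−1)λ)` for `25/16 ≤ β ≤ 2`, `z(1+ε) = 1`,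
`z ≥ 9/10`, `0 ≤ λ`, `V ∈ [0,1]`, pin `(2β−1)λ ≤ 1 + V²`. -/
theorem lemma_I {β ε z l V : ℝ} (hβ : 25 / 16 ≤ β) (hβ2 : β ≤ 2) (hzε : z * (1 + ε) = 1)
    (hz : 9 / 10 ≤ z) (hε : 0 ≤ ε) (hV0 : 0 ≤ V) (hV1 : V ≤ 1)
    (hpin : (2 * β - 1) * l ≤ 1 + V ^ 2) :
    z * l * (ε + 1 - V) ≤ 16 / 25 * (1 - (β - 1) * l) := by
  have hz1 : z ≤ 1 := by nlinarith
  have hg : 0 < 2 * β - 1 := by linarith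
  -- K = zα + (16/25)(β−1) = c₁ − zV, c₁ = 1 + (16/25)(β−1)
  have hK : 0 ≤ 1 - z * V + 16 / 25 * (β - 1) := by nlinarith
  have h1 : (2 * β - 1) * l * (1 - z * V + 16 / 25 * (β - 1)) ≤
      (1 + V ^ 2) * (1 - z * V + 16 / 25 * (β - 1)) := mul_le_mul_of_nonneg_right hpin hK
  have h2 : (1 + 16 / 25 * (β - 1)) * V ≤ z * (1 + V ^ 2) := by
    nlinarith [sq_nonneg (V - 9 / 10), mul_nonneg hV0 hV0]
  have h3 : (1 + V ^ 2) * (1 - z * V + 16 / 25 * (β - 1)) ≤ 1 + 16 / 25 * (β - 1) := by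
    nlinarith [mul_nonneg hV0 (sub_nonneg.mpr h2)]
  have h4 : 1 + 16 / 25 * (β - 1) ≤ 16 / 25 * (2 * β - 1) := by linarith
  have key : 0 ≤ (2 * β - 1) * (16 / 25 * (1 - (β - 1) * l) - z * l * (ε + 1 - V)) := by
    have e : (2 * β - 1) * (16 / 25 * (1 - (β - 1) * l) - z * l * (ε + 1 - V)) =
        16 / 25 * (2 * β - 1) - (2 * β - 1) * l * (z * (1 + ε) - z * V + 16 / 25 * (β - 1)) := by ring
    rw [e, hzε]
    linarith
  have := (mul_nonneg_iff_of_pos_left hg).mp key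
  linarith

/-- **Gain inequality (U).**  `β(2+V)·λ(ε+1−V) ≤ 2(1+ε)(1 − (β−1)λ)` for `1 ≤ β ≤ 2`, `0 ≤ ε`,
`2ε(3β−1) ≤ 2−β`, `V ∈ [0,1]`, pin `(2β−1)λ ≤ 1+V²`.  At the pin boundary the slack is
`V·[β(1−ε)(1−V)² + ((2−β) − 2ε(3β−1))V + βV³]/(2β−1)`. -/
theorem lemma_U {β ε l V : ℝ} (hβ1 : 1 ≤ β) (hε0 : 0 ≤ ε)
    (hε : 2 * ε * (3 * β - 1) ≤ 2 - β) (hV0 : 0 ≤ V) (hV1 : V ≤ 1)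
    (hpin : (2 * β - 1) * l ≤ 1 + V ^ 2) :
    β * (2 + V) * l * (ε + 1 - V) ≤ 2 * (1 + ε) * (1 - (β - 1) * l) := by
  have hg : 0 < 2 * β - 1 := by linarith
  have hε1 : ε ≤ 1 := by nlinarith
  -- c = coefficient of λ
  have hc : 0 ≤ 2 * (1 + ε) * (β - 1) + β * (2 + V) * (ε + 1 - V) := by
    have : 0 ≤ β * (2 + V) * (ε + 1 - V) := by
      apply mul_nonneg (mul_nonneg (by linarith) (by linarith)) (by linarith)
    nlinarith
  have h1 : (2 * β - 1) * l * (2 * (1 + ε) * (β - 1) + β * (2 + V) * (ε + 1 - V)) ≤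
      (1 + V ^ 2) * (2 * (1 + ε) * (β - 1) + β * (2 + V) * (ε + 1 - V)) :=
    mul_le_mul_of_nonneg_right hpin hc
  have hQ : 0 ≤ V * (β * (1 - ε) * (1 - V) ^ 2 + ((2 - β) - 2 * ε * (3 * β - 1)) * V + β * V ^ 3) := by
    apply mul_nonneg hV0
    have t1 : 0 ≤ β * (1 - ε) * (1 - V) ^ 2 := mul_nonneg (mul_nonneg (by linarith) (by linarith)) (sq_nonneg _)
    have t2 : 0 ≤ ((2 - β) - 2 * ε * (3 * β - 1)) * V := mul_nonneg (by linarith) hV0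
    have t3 : 0 ≤ β * V ^ 3 := mul_nonneg (by linarith) (pow_nonneg hV0 3)
    linarith
  have e : 2 * (1 + ε) * (2 * β - 1) - (1 + V ^ 2) * (2 * (1 + ε) * (β - 1) + β * (2 + V) * (ε + 1 - V)) =
      V * (β * (1 - ε) * (1 - V) ^ 2 + ((2 - β) - 2 * ε * (3 * β - 1)) * V + β * V ^ 3) := by ring
  have key : 0 ≤ (2 * β - 1) * (2 * (1 + ε) * (1 - (β - 1) * l) - β * (2 + V) * l * (ε + 1 - V)) := by
    have e2 : (2 * β - 1) * (2 * (1 + ε) * (1 - (β - 1) * l) - β * (2 + V) * l * (ε + 1 - V)) =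
        2 * (1 + ε) * (2 * β - 1) - (2 * β - 1) * l * (2 * (1 + ε) * (β - 1) + β * (2 + V) * (ε + 1 - V)) := by
      ring
    rw [e2]
    linarith
  have := (mul_nonneg_iff_of_pos_left hg).mp key
  linarith

/-- **Sharpened gain on the deep range (U').**  For `199/100 ≤ β ≤ 2`, `0 ≤ ε ≤ 1/100`, `0 ≤ λ`,
`0 ≤ V ≤ 4(2−β)`, pin `(2β−1)λ ≤ 1+V²`:
`β((1+ε) + (1 − 4(2−β))V)·λ(ε+1−V) ≤ (1+ε)²(1 − (β−1)λ)`. -/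
theorem lemma_U' {β ε l V : ℝ} (hβ : 199 / 100 ≤ β) (hβ2 : β ≤ 2) (hε0 : 0 ≤ ε) (hε1 : ε ≤ 1 / 100)
    (hV0 : 0 ≤ V) (hV4 : V ≤ 4 * (2 - β)) (hpin : (2 * β - 1) * l ≤ 1 + V ^ 2) :
    β * ((1 + ε) + (1 - 4 * (2 - β)) * V) * l * (ε + 1 - V) ≤ (1 + ε) ^ 2 * (1 - (β - 1) * l) := by
  have hg : 0 < 2 * β - 1 := by linarith
  have hV1 : V ≤ 1 / 25 := by linarith
  have hγ : 0 ≤ 1 - 4 * (2 - β) := by linarith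
  -- c₂ = coefficient of λ
  have hc : 0 ≤ (1 + ε) ^ 2 * (β - 1) + β * ((1 + ε) + (1 - 4 * (2 - β)) * V) * (ε + 1 - V) := by
    have : 0 ≤ β * ((1 + ε) + (1 - 4 * (2 - β)) * V) * (ε + 1 - V) :=
      mul_nonneg (mul_nonneg (by linarith) (by nlinarith)) (by linarith)
    nlinarith
  have h1 : (2 * β - 1) * l * ((1 + ε) ^ 2 * (β - 1) + β * ((1 + ε) + (1 - 4 * (2 - β)) * V) * (ε + 1 - V)) ≤
      (1 + V ^ 2) * ((1 + ε) ^ 2 * (β - 1) + β * ((1 + ε) + (1 - 4 * (2 - β)) * V) * (ε + 1 - V)) :=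
    mul_le_mul_of_nonneg_right hpin hc
  -- P₂ = 4βδsV − V²(s²g − βγ') + 4βδsV³ + βγ'V⁴ ≥ 0 on V ≤ 4δ
  have hA : 0 ≤ (1 + ε) ^ 2 * (2 * β - 1) - β * (1 - 4 * (2 - β)) := by nlinarith
  have hB : V * ((1 + ε) ^ 2 * (2 * β - 1) - β * (1 - 4 * (2 - β))) ≤
      4 * (2 - β) * ((1 + ε) ^ 2 * (2 * β - 1) - β * (1 - 4 * (2 - β))) :=
    mul_le_mul_of_nonneg_right hV4 hA
  have hC : 0 ≤ β * (1 + ε) - (1 + ε) ^ 2 * (2 * β - 1) + β * (1 - 4 * (2 - β)) := by nlinarith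
  have hlin : 0 ≤ 4 * β * (2 - β) * (1 + ε) - V * ((1 + ε) ^ 2 * (2 * β - 1) - β * (1 - 4 * (2 - β))) := by
    have : 0 ≤ 4 * (2 - β) * (β * (1 + ε) - (1 + ε) ^ 2 * (2 * β - 1) + β * (1 - 4 * (2 - β))) :=
      mul_nonneg (by linarith) hC
    nlinarith
  have hP : 0 ≤ V * (4 * β * (2 - β) * (1 + ε) - V * ((1 + ε) ^ 2 * (2 * β - 1) - β * (1 - 4 * (2 - β))))
      + 4 * β * (2 - β) * (1 + ε) * V ^ 3 + β * (1 - 4 * (2 - β)) * V ^ 4 := by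
    have t1 := mul_nonneg hV0 hlin
    have t2 : 0 ≤ 4 * β * (2 - β) * (1 + ε) * V ^ 3 :=
      mul_nonneg (mul_nonneg (mul_nonneg (by linarith) (by linarith)) (by linarith)) (pow_nonneg hV0 3)
    have t3 : 0 ≤ β * (1 - 4 * (2 - β)) * V ^ 4 := mul_nonneg (mul_nonneg (by linarith) hγ) (pow_nonneg hV0 4)
    linarith
  have e : (1 + ε) ^ 2 * (2 * β - 1) -
      (1 + V ^ 2) * ((1 + ε) ^ 2 * (β - 1) + β * ((1 + ε) + (1 - 4 * (2 - β)) * V) * (ε + 1 - V)) =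
      V * (4 * β * (2 - β) * (1 + ε) - V * ((1 + ε) ^ 2 * (2 * β - 1) - β * (1 - 4 * (2 - β))))
      + 4 * β * (2 - β) * (1 + ε) * V ^ 3 + β * (1 - 4 * (2 - β)) * V ^ 4 := by ring
  have key : 0 ≤ (2 * β - 1) * ((1 + ε) ^ 2 * (1 - (β - 1) * l) -
      β * ((1 + ε) + (1 - 4 * (2 - β)) * V) * l * (ε + 1 - V)) := by
    have e2 : (2 * β - 1) * ((1 + ε) ^ 2 * (1 - (β - 1) * l) -
        β * ((1 + ε) + (1 - 4 * (2 - β)) * V) * l * (ε + 1 - V)) =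
        (1 + ε) ^ 2 * (2 * β - 1) - (2 * β - 1) * l *
          ((1 + ε) ^ 2 * (β - 1) + β * ((1 + ε) + (1 - 4 * (2 - β)) * V) * (ε + 1 - V)) := by ring
    rw [e2]
    linarith
  have := (mul_nonneg_iff_of_pos_left hg).mp key
  linarith

/-! ## 2. The pair: the exclusion on the deep range, and condition (II) -/

set_option maxHeartbeats 1000000 in
/-- **Exclusion ⇒ not both deep.**  On the deep range `V, V' ≤ 4(2−β)` (`199/100 ≤ β < 2`, pins,
`βλ, βλ' ≤ 1`, `z ≤ 1`) the product-floor exclusion `V_f ≤ V_P` (`V_f ≥ 0`) forces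
`(293/100)·V_f ≤ V + V'`. -/
theorem exclusion_sum {β z l l' V V' VP Vf : ℝ} (hβ : 199 / 100 ≤ β) (hβ2 : β < 2)
    (hz1 : z ≤ 1) (hl : 0 < l) (hl1 : β * l ≤ 1) (hl' : 0 < l') (hl'1 : β * l' ≤ 1)
    (hV0 : 0 ≤ V) (hV4 : V ≤ 4 * (2 - β)) (hV'0 : 0 ≤ V') (hV'4 : V' ≤ 4 * (2 - β))
    (hp : |1 - (2 * β - 1) * l| ≤ V ^ 2) (hp' : |1 - (2 * β - 1) * l'| ≤ V' ^ 2)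
    (hP : VP * (l + l' - (2 * β - 1) * l * l') =
      l' * (1 - β * l) * V' + l * (1 - β * l') * V + z * l * l' * V * V')
    (hVf0 : 0 ≤ Vf) (hVP : Vf ≤ VP) : 293 / 100 * Vf ≤ V + V' := by
  set g := 2 * β - 1 with hg
  have hg0 : 0 < g := by rw [hg]; linarith
  obtain ⟨hpL, hpU⟩ := abs_le.mp hp
  obtain ⟨hpL', hpU'⟩ := abs_le.mp hp'
  have hglU : g * l ≤ 1 + V ^ 2 := by linarith
  have hglL : 1 - V ^ 2 ≤ g * l := by linarith
  have hglU' : g * l' ≤ 1 + V' ^ 2 := by linarith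
  have hglL' : 1 - V' ^ 2 ≤ g * l' := by linarith
  have hδ : 2 - β ≤ 1 / 100 := by linarith
  have hδ0 : 0 < 2 - β := by linarith
  have hVs : V ≤ 1 / 25 := by linarith
  have hV's : V' ≤ 1 / 25 := by linarith
  have hV2 : V ^ 2 ≤ 16 * (2 - β) ^ 2 := by nlinarith
  have hV'2 : V' ^ 2 ≤ 16 * (2 - β) ^ 2 := by nlinarith
  -- λ_P > 0 and V_f λ_P ≤ num
  have hlam : 0 < l + l' - g * l * l' := by
    have : l + l' - g * l * l' = l * (1 - β * l') + l' * (1 - β * l) + l * l' := by rw [hg]; ring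
    rw [this]; nlinarith [mul_pos hl hl']
  have hnum : Vf * (l + l' - g * l * l') ≤
      l' * (1 - β * l) * V' + l * (1 - β * l') * V + z * l * l' * V * V' := by
    rw [← hP]; exact mul_le_mul_of_nonneg_right hVP hlam.le
  -- upper bounds for the three terms of num, scaled by g²
  have hβ0 : (0:ℝ) ≤ β := by linarith
  have hgl : 0 ≤ g * l := by positivity
  have hgl' : 0 ≤ g * l' := by positivity
  have h1βl : 0 ≤ g * (1 - β * l) := mul_nonneg hg0.le (by linarith)
  have h1βl' : 0 ≤ g * (1 - β * l') := mul_nonneg hg0.le (by linarith)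
  have hb1 : g * (1 - β * l) ≤ (β - 1) + β * V ^ 2 := by
    have e : g * (1 - β * l) = g - β * (g * l) := by ring
    rw [e]; nlinarith [mul_le_mul_of_nonneg_left hglL hβ0]
  have hb1' : g * (1 - β * l') ≤ (β - 1) + β * V' ^ 2 := by
    have e : g * (1 - β * l') = g - β * (g * l') := by ring
    rw [e]; nlinarith [mul_le_mul_of_nonneg_left hglL' hβ0]
  have hT1 : (g * l') * (g * (1 - β * l)) * V' ≤ (1 + V' ^ 2) * ((β - 1) + β * V ^ 2) * V' := by
    apply mul_le_mul_of_nonneg_right _ hV'0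
    exact mul_le_mul hglU' hb1 h1βl (by positivity)
  have hT2 : (g * l) * (g * (1 - β * l')) * V ≤ (1 + V ^ 2) * ((β - 1) + β * V' ^ 2) * V := by
    apply mul_le_mul_of_nonneg_right _ hV0
    exact mul_le_mul hglU hb1' h1βl' (by positivity)
  have hT3 : z * (g * l) * (g * l') * (V * V') ≤ (1 + V ^ 2) * (1 + V' ^ 2) * (V * V') := by
    have hVV : 0 ≤ V * V' := mul_nonneg hV0 hV'0
    have hP0 : 0 ≤ (g * l) * (g * l') := mul_nonneg hgl hgl'
    have s1 : z * ((g * l) * (g * l')) ≤ (g * l) * (g * l') := by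
      have := mul_le_mul_of_nonneg_right hz1 hP0; linarith
    have s2 : (g * l) * (g * l') ≤ (1 + V ^ 2) * (1 + V' ^ 2) :=
      mul_le_mul hglU hglU' hgl' (by positivity)
    have := mul_le_mul_of_nonneg_right (s1.trans s2) hVV
    linarith
  -- lower bound for g λ_P = 1 − (1 − gl)(1 − gl')
  have hL : 1 - V ^ 2 * V' ^ 2 ≤ g * (l + l' - g * l * l') := by
    have e : g * (l + l' - g * l * l') = 1 - (1 - g * l) * (1 - g * l') := by ring
    rw [e]
    have : (1 - g * l) * (1 - g * l') ≤ V ^ 2 * V' ^ 2 := by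
      calc (1 - g * l) * (1 - g * l') ≤ |(1 - g * l) * (1 - g * l')| := le_abs_self _
        _ = |1 - g * l| * |1 - g * l'| := abs_mul _ _
        _ ≤ V ^ 2 * V' ^ 2 := mul_le_mul hp hp' (abs_nonneg _) (sq_nonneg _)
    linarith
  -- combine: g·V_f·(gλ) ≤ g²·num ≤ (V+V')((β−1) + (5/2)(2−β))
  have hnum2 : g * Vf * (g * (l + l' - g * l * l')) ≤
      (g * l') * (g * (1 - β * l)) * V' + (g * l) * (g * (1 - β * l')) * V + z * (g * l) * (g * l') * (V * V') := by
    have e1 : g * Vf * (g * (l + l' - g * l * l')) = g * g * (Vf * (l + l' - g * l * l')) := by ring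
    have e2 : (g * l') * (g * (1 - β * l)) * V' + (g * l) * (g * (1 - β * l')) * V + z * (g * l) * (g * l') * (V * V') =
        g * g * (l' * (1 - β * l) * V' + l * (1 - β * l') * V + z * l * l' * V * V') := by ring
    rw [e1, e2]
    exact mul_le_mul_of_nonneg_left hnum (by positivity)
  have hδsq : (2 - β) ^ 2 ≤ 1 / 100 * (2 - β) := by nlinarith [hδ, hδ0]
  have hδ2' : (2 - β) ^ 2 ≤ 1 / 10000 := by nlinarith [hδ, hδ0]
  have hVV4 : V ^ 2 * V' ^ 2 ≤ 256 / 10000 * (2 - β) ^ 2 := by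
    have h1 := mul_le_mul hV2 hV'2 (sq_nonneg _) (by positivity)
    have h2 : 16 * (2 - β) ^ 2 * (16 * (2 - β) ^ 2) = 256 * ((2 - β) ^ 2 * (2 - β) ^ 2) := by ring
    have h3 := mul_le_mul_of_nonneg_left hδ2' (sq_nonneg (2 - β))
    linarith
  have t1 : β * V ^ 2 ≤ 32 * (2 - β) ^ 2 := by
    have := mul_le_mul_of_nonneg_right hβ2.le (sq_nonneg V); linarith
  have t1' : β * V' ^ 2 ≤ 32 * (2 - β) ^ 2 := by
    have := mul_le_mul_of_nonneg_right hβ2.le (sq_nonneg V'); linarith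
  have t2 : (β - 1) * V' ^ 2 ≤ 16 * (2 - β) ^ 2 := by
    have := mul_le_mul_of_nonneg_right (by linarith : β - 1 ≤ 1) (sq_nonneg V'); linarith
  have t2' : (β - 1) * V ^ 2 ≤ 16 * (2 - β) ^ 2 := by
    have := mul_le_mul_of_nonneg_right (by linarith : β - 1 ≤ 1) (sq_nonneg V); linarith
  have t3 : β * (V ^ 2 * V' ^ 2) ≤ (2 - β) ^ 2 := by
    have := mul_le_mul_of_nonneg_right hβ2.le (mul_nonneg (sq_nonneg V) (sq_nonneg V')); linarith
  have hc1 : (1 + V' ^ 2) * ((β - 1) + β * V ^ 2) ≤ (β - 1) + 49 * (2 - β) ^ 2 := by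
    have e : (1 + V' ^ 2) * ((β - 1) + β * V ^ 2) = (β - 1) + β * V ^ 2 + (β - 1) * V' ^ 2 + β * (V ^ 2 * V' ^ 2) := by
      ring
    rw [e]; linarith
  have hc2 : (1 + V ^ 2) * ((β - 1) + β * V' ^ 2) ≤ (β - 1) + 49 * (2 - β) ^ 2 := by
    have e : (1 + V ^ 2) * ((β - 1) + β * V' ^ 2) = (β - 1) + β * V' ^ 2 + (β - 1) * V ^ 2 + β * (V ^ 2 * V' ^ 2) := by
      ring
    rw [e]; linarith
  have hc3 : (1 + V ^ 2) * (1 + V' ^ 2) ≤ 10033 / 10000 := by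
    have e : (1 + V ^ 2) * (1 + V' ^ 2) = 1 + V ^ 2 + V' ^ 2 + V ^ 2 * V' ^ 2 := by ring
    rw [e]; linarith
  have hVV : V * V' ≤ 2 * (2 - β) * (V + V') := by
    have a1 := mul_le_mul_of_nonneg_right hV4 hV'0
    have a2 := mul_le_mul_of_nonneg_right hV'4 hV0
    linarith
  have hUB : (g * l') * (g * (1 - β * l)) * V' + (g * l) * (g * (1 - β * l')) * V + z * (g * l) * (g * l') * (V * V')
      ≤ (V + V') * ((β - 1) + 5 / 2 * (2 - β)) := by
    have u1 := mul_le_mul_of_nonneg_right hc1 hV'0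
    have u2 := mul_le_mul_of_nonneg_right hc2 hV0
    have u3 : (1 + V ^ 2) * (1 + V' ^ 2) * (V * V') ≤ 10033 / 10000 * (V * V') :=
      mul_le_mul_of_nonneg_right hc3 (mul_nonneg hV0 hV'0)
    have hδ2 : 49 * (2 - β) ^ 2 ≤ 49 / 100 * (2 - β) := by linarith
    have u4 := mul_le_mul_of_nonneg_right hδ2 (add_nonneg hV0 hV'0)
    have u5 : 10033 / 10000 * (V * V') ≤ 10033 / 10000 * (2 * (2 - β) * (V + V')) := by linarith
    have u6 : 0 ≤ (2 - β) * (V + V') := mul_nonneg hδ0.le (add_nonneg hV0 hV'0)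
    linarith [hT1, hT2, hT3, u1, u2, u3, u4, u5, u6]
  -- g(1 − V²V'²) ≥ 2979/1000 and (β−1) + (5/2)(2−β) ≤ 203/200
  have hlow : 2979 / 1000 * Vf ≤ g * Vf * (g * (l + l' - g * l * l')) := by
    have hsmall : V ^ 2 * V' ^ 2 ≤ 1 / 10000 := by linarith
    have s1 : 298 / 100 * (9999 / 10000) ≤ g * (1 - V ^ 2 * V' ^ 2) :=
      mul_le_mul (by rw [hg]; linarith) (by linarith) (by norm_num) hg0.le
    have s1' := mul_le_mul_of_nonneg_right s1 hVf0
    have s2 : g * Vf * (1 - V ^ 2 * V' ^ 2) ≤ g * Vf * (g * (l + l' - g * l * l')) :=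
      mul_le_mul_of_nonneg_left hL (mul_nonneg hg0.le hVf0)
    linarith [s1', s2]
  have hhigh : (V + V') * ((β - 1) + 5 / 2 * (2 - β)) ≤ (V + V') * (203 / 200) :=
    mul_le_mul_of_nonneg_left (by linarith) (add_nonneg hV0 hV'0)
  linarith [hnum2, hUB, hlow, hhigh, hVf0]

set_option maxHeartbeats 1000000 in
/-- **Condition (II) for a pair.**  From the gain inequalities of both factors (`hU`), their deep
sharpenings (`hU'`), the exclusion consequence on the deep range (`hex`) and the floor bound
`V_f ≥ (12/25)(2−β)`: `z·λλ'αα' ≤ (9/25)·A + (7/50)·B`. -/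
theorem pair_II {β ε z l l' V V' Vf : ℝ} (hβ : 199 / 100 ≤ β) (hβ2 : β < 2) (hzε : z * (1 + ε) = 1)
    (hε0 : 0 ≤ ε) (hε1 : ε ≤ 1 / 100) (hla : 0 ≤ l * (ε + 1 - V)) (hl'a : 0 ≤ l' * (ε + 1 - V'))
    (hV0 : 0 ≤ V) (hV'0 : 0 ≤ V')
    (hU1 : β * (2 + V) * l * (ε + 1 - V) ≤ 2 * (1 + ε) * (1 - (β - 1) * l))
    (hU2 : β * (2 + V') * l' * (ε + 1 - V') ≤ 2 * (1 + ε) * (1 - (β - 1) * l'))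
    (hU'1 : V ≤ 4 * (2 - β) →
      β * ((1 + ε) + (1 - 4 * (2 - β)) * V) * l * (ε + 1 - V) ≤ (1 + ε) ^ 2 * (1 - (β - 1) * l))
    (hU'2 : V' ≤ 4 * (2 - β) →
      β * ((1 + ε) + (1 - 4 * (2 - β)) * V') * l' * (ε + 1 - V') ≤ (1 + ε) ^ 2 * (1 - (β - 1) * l'))
    (hex : V ≤ 4 * (2 - β) → V' ≤ 4 * (2 - β) → 293 / 100 * Vf ≤ V + V')
    (hVf : 12 / 25 * (2 - β) ≤ Vf) (hVfV' : Vf ≤ V') :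
    z * l * l' * (ε + 1 - V) * (ε + 1 - V') ≤
      9 / 25 * ((1 - (β - 1) * l') * (l * (ε + 1 - V))) + 7 / 50 * ((1 - (β - 1) * l) * (l' * (ε + 1 - V'))) := by
  set a := l * (ε + 1 - V) with ha
  set a' := l' * (ε + 1 - V') with ha'
  have hX : 0 ≤ a * a' := mul_nonneg hla hl'a
  have eD : z * l * l' * (ε + 1 - V) * (ε + 1 - V') = z * (a * a') := by rw [ha, ha']; ring
  rw [eD]
  have hs : 0 < 1 + ε := by linarith
  have hzX : (1 + ε) * (z * (a * a')) = a * a' := by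
    have : (1 + ε) * (z * (a * a')) = (z * (1 + ε)) * (a * a') := by ring
    rw [this, hzε, one_mul]
  have hU1' : β * (2 + V) * a ≤ 2 * (1 + ε) * (1 - (β - 1) * l) := by rw [ha]; linarith [hU1]
  have hU2' : β * (2 + V') * a' ≤ 2 * (1 + ε) * (1 - (β - 1) * l') := by rw [ha']; linarith [hU2]
  have p1 := mul_le_mul_of_nonneg_right hU2' hla   -- β(2+V')a'·a ≤ 2s(1−(β−1)l')·a
  have p2 := mul_le_mul_of_nonneg_right hU1' hl'a  -- β(2+V)a·a' ≤ 2s(1−(β−1)l)·a'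
  rcases le_or_gt (4 * (2 - β)) V with hV4 | hV4
  · -- factor 1 not deep
    have hcoef : 2 ≤ β * (1 + 7 / 50 * V) := by nlinarith
    have p4 := mul_le_mul_of_nonneg_right hcoef hX
    have p3 : 0 ≤ β * V' * (a' * a) := mul_nonneg (mul_nonneg (by linarith) hV'0) (mul_nonneg hl'a hla)
    refine le_of_mul_le_mul_left ?_ (by linarith : (0:ℝ) < 2 * (1 + ε))
    linarith [p1, p2, p3, p4, hzX]
  rcases le_or_gt (4 * (2 - β)) V' with hV'4 | hV'4
  · -- factor 2 not deep
    have hcoef : 2 ≤ β * (1 + 9 / 25 * V') := by nlinarith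
    have p4 := mul_le_mul_of_nonneg_right hcoef hX
    have p3 : 0 ≤ β * V * (a * a') := mul_nonneg (mul_nonneg (by linarith) hV0) hX
    refine le_of_mul_le_mul_left ?_ (by linarith : (0:ℝ) < 2 * (1 + ε))
    linarith [p1, p2, p3, p4, hzX]
  -- both deep: sharpened gains + exclusion
  have hW1 : β * ((1 + ε) + (1 - 4 * (2 - β)) * V) * a ≤ (1 + ε) ^ 2 * (1 - (β - 1) * l) := by
    have := hU'1 hV4.le; rw [ha]; linarith
  have hW2 : β * ((1 + ε) + (1 - 4 * (2 - β)) * V') * a' ≤ (1 + ε) ^ 2 * (1 - (β - 1) * l') := by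
    have := hU'2 hV'4.le; rw [ha']; linarith
  have q1 := mul_le_mul_of_nonneg_right hW2 hla
  have q2 := mul_le_mul_of_nonneg_right hW1 hl'a
  have hsum := hex hV4.le hV'4.le
  have hcomb : 3 / 10 * (2 - β) ≤ 36 / 100 * V' + 14 / 100 * V := by linarith
  have hβγ : 191 / 100 ≤ β * (1 - 4 * (2 - β)) := by nlinarith
  have hprod : 191 / 100 * (3 / 10 * (2 - β)) ≤ β * (1 - 4 * (2 - β)) * (36 / 100 * V' + 14 / 100 * V) :=
    mul_le_mul hβγ hcomb (by linarith) (by linarith)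
  have hcoef : (1 + ε) ≤ β * ((1 + ε) / 2 + (1 - 4 * (2 - β)) * (36 / 100 * V' + 14 / 100 * V)) := by
    nlinarith
  have p5 := mul_le_mul_of_nonneg_right hcoef hX
  have hzX2 : (1 + ε) ^ 2 * (z * (a * a')) = (1 + ε) * (a * a') := by
    have : (1 + ε) ^ 2 * (z * (a * a')) = (1 + ε) * ((z * (1 + ε)) * (a * a')) := by ring
    rw [this, hzε, one_mul]
  refine le_of_mul_le_mul_left ?_ (by positivity : (0:ℝ) < (1 + ε) ^ 2)
  linarith [q1, q2, p5, hzX2]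

end Summit.MatrixMultiplication.MatrixMultiplication.Theorems.FarEdgeDescentCornerLemmas

end
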